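import Summits.CriticalPhenomena.Ising3DConformalLimit.Theorems.PerfectScreeningGaussianLimitNotScreenedCrossTermLimit
import Summits.CriticalPhenomena.Ising3DConformalLimit.Theorems.PerfectScreeningGaussianLimitNotScreenedDoubleTermAutocorrelation
import Summits.CriticalPhenomena.Ising3DConformalLimit.Theorems.PerfectScreeningGaussianLimitNotScreenedDoubleTermKernelSum
import Summits.CriticalPhenomena.Ising3DConformalLimit.Theorems.PerfectScreeningGaussianLimitNotScreenedDoubleTermFubini
import Summits.CriticalPhenomena.Ising3DConformalLimit.Theorems.MoebiusLimitExists.Negative.EtaExists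
import HarnessLib

/-!
# Crux `GaussianLimitNotScreened` (stmt-CriticalPhenomena-13886), line `single-layer-linear-regression`:
# the two-point RIEMANN LIMIT of the layer regression form (the planner's stub B, recomposed)

THEOREM-ONLY file. Lead c1's registered stub B2 `stub_doubleTermLimit` (the layer double sum against the diagonal
singularity) and the planner's stub B `stub_formRiemannLimit`

  `layerRegressionForm(n, layerBox R n, n⁻²φ(·/n)) / G(2n e₀) → 1 − 4^Δ·Q_Δ(φ)`

are now THEOREMS: B2 is glued (lead c2's skeleton glue `doubleTermLimit_of_stubs`, moved here verbatim) from the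
three LANDED stubs of lead c2's reshape — B2a `stub_doubleTermAutocorrelation` (p127772), B2b
`stub_doubleTermKernelSum` (p128164) and B2c `stub_doubleTermFubini` (p127612) — and B is lead c1's glue
`formRiemannLimit_of_stubs` fed with the landed B1 `stub_crossTermLimit` (p126768) and B2.

References: N. H. Bingham, C. M. Goldie, J. L. Teugels, Regular Variation (1987), §1.5; folklore Riemann sums.
-/

noncomputable section

namespace Summit.CriticalPhenomena.Ising3DConformalLimit.Cruxes.GaussianLimitNotScreened.SingleLayerLinearRegression

open MeasureTheory Filter Topology
open Literature.Probability.LatticeModels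
open Summit.CriticalPhenomena.Ising3DConformalLimit.MoebiusLimitExistsNegative (delta_mem_Icc_of_covariantLimit)

/-- **B2 from B2a + B2b + B2c** (lead c1's registered `stub_doubleTermLimit`, now a theorem modulo the three
registered stubs above): with `T_n` the layer double sum, `U_n := Σ_z n⁻²Ψ(z/n)G((0,z))`, `M_n := Σ_z n⁻²G((0,z))`
(`z ∈ layerBox 2R n`) and `g_n := G(2n e₀)`: `|T_n − U_n| ≤ ηM_n ≤ ηC g_n` eventually (B2a, B2b-mass), and
`U_n/g_n → 4^Δ∫Ψ‖·‖^{−2Δ} = 4^Δ∫∫φφ‖v−w‖^{−2Δ}` (B2b-limit with B2c); `η → 0`. [folklore] -/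
theorem doubleTermLimit_of_stubs
    (hB2a : ∀ (φ : E2 → ℝ) (R : ℕ), Continuous φ → (∀ v : E2, (R : ℝ) ≤ ‖v‖ → φ v = 0) →
      ∀ η : ℝ, 0 < η → ∀ᶠ n : ℕ in atTop,
        |(∑ u ∈ layerBox R n, ∑ v ∈ layerBox R n,
            profileCoeff φ n u * profileCoeff φ n v * criticalTwoPoint 3 (Fin.cons 0 (u - v))) -
          ∑ z ∈ layerBox (2 * R) n,
            (∫ y : E2, φ y * φ (y - (n : ℝ)⁻¹ • planeVec z)) / (n : ℝ) ^ 2 *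
              criticalTwoPoint 3 (Fin.cons 0 z)| ≤
        η * ∑ z ∈ layerBox (2 * R) n, criticalTwoPoint 3 (Fin.cons 0 z) / (n : ℝ) ^ 2)
    (hB2b : ∀ (ρ : ℝ → ℝ) (Δ : ℝ) (S : CorrFamily 3), (∀ δ ∈ Set.Ioc (0:ℝ) 1, 0 < ρ δ) →
      HasPointwiseScalingLimit (criticalCorr 3) ρ S → IsNondegenerateTwoPoint S →
      IsMoebiusCovariant Δ S →
      (∀ R : ℕ, ∃ C : ℝ, ∀ᶠ n : ℕ in atTop,
          ∑ z ∈ layerBox R n, criticalTwoPoint 3 (Fin.cons 0 z) / (n : ℝ) ^ 2 ≤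
            C * criticalTwoPoint 3 (Pi.single 0 ((2 * n : ℕ) : ℤ))) ∧
      ∀ (Ψ : E2 → ℝ) (R : ℕ), Continuous Ψ → (∀ v : E2, (R : ℝ) ≤ ‖v‖ → Ψ v = 0) →
        Tendsto (fun n : ℕ =>
            (∑ z ∈ layerBox R n, Ψ ((n : ℝ)⁻¹ • planeVec z) / (n : ℝ) ^ 2 *
                criticalTwoPoint 3 (Fin.cons 0 z)) /
              criticalTwoPoint 3 (Pi.single 0 ((2 * n : ℕ) : ℤ)))
          atTop (𝓝 ((4:ℝ) ^ Δ * ∫ v : E2, Ψ v * ‖v‖ ^ (-(2 * Δ)))))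
    (hB2c : ∀ Δ : ℝ, 1 / 2 ≤ Δ → Δ < 1 → ∀ (φ : E2 → ℝ) (R : ℕ), Continuous φ →
      (∀ v : E2, (R : ℝ) ≤ ‖v‖ → φ v = 0) →
      Continuous (fun z : E2 => ∫ y : E2, φ y * φ (y - z)) ∧
      (∀ z : E2, ((2 * R : ℕ) : ℝ) ≤ ‖z‖ → ∫ y : E2, φ y * φ (y - z) = 0) ∧
      (∫ v : E2, ∫ w : E2, φ v * φ w * ‖v - w‖ ^ (-(2 * Δ))) =
        ∫ z : E2, (∫ y : E2, φ y * φ (y - z)) * ‖z‖ ^ (-(2 * Δ))) :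
    ∀ (ρ : ℝ → ℝ) (Δ : ℝ) (S : CorrFamily 3), (∀ δ ∈ Set.Ioc (0:ℝ) 1, 0 < ρ δ) →
      HasPointwiseScalingLimit (criticalCorr 3) ρ S → IsNondegenerateTwoPoint S →
      IsMoebiusCovariant Δ S →
      ∀ (φ : EuclideanSpace ℝ (Fin 2) → ℝ) (R : ℕ), Continuous φ →
        (∀ v : EuclideanSpace ℝ (Fin 2), (R : ℝ) ≤ ‖v‖ → φ v = 0) →
        Tendsto (fun n : ℕ =>
            (∑ u ∈ Fintype.piFinset (fun _ : Fin 2 => Finset.Icc (-((R * n : ℕ) : ℤ)) ((R * n : ℕ) : ℤ)),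
              ∑ v ∈ Fintype.piFinset (fun _ : Fin 2 => Finset.Icc (-((R * n : ℕ) : ℤ)) ((R * n : ℕ) : ℤ)),
                φ ((n : ℝ)⁻¹ • (WithLp.toLp 2 fun i => (u i : ℝ))) / (n : ℝ) ^ 2 *
                  (φ ((n : ℝ)⁻¹ • (WithLp.toLp 2 fun i => (v i : ℝ))) / (n : ℝ) ^ 2) *
                  criticalTwoPoint 3 (Fin.cons 0 (u - v))) /
            criticalTwoPoint 3 (Pi.single 0 ((2 * n : ℕ) : ℤ)))
          atTop (𝓝 ((4:ℝ) ^ Δ * ∫ v : EuclideanSpace ℝ (Fin 2), ∫ w : EuclideanSpace ℝ (Fin 2),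
            φ v * φ w * ‖v - w‖ ^ (-(2 * Δ)))) := by
  intro ρ Δ S hρ hlim hnd hMo φ R hφc hφs
  have hwin : Δ ∈ Set.Icc (1 / 2 : ℝ) (3 / 4) :=
    delta_mem_Icc_of_covariantLimit hρ hlim hnd hMo.isEuclideanInvariant.2 hMo.isScaleCovariant
  have hΔ1 : Δ < 1 := lt_of_le_of_lt hwin.2 (by norm_num)
  obtain ⟨hΨc, hΨs, hFub⟩ := hB2c Δ hwin.1 hΔ1 φ R hφc hφs
  obtain ⟨hmass, hker⟩ := hB2b ρ Δ S hρ hlim hnd hMo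
  obtain ⟨C, hC⟩ := hmass (2 * R)
  -- abbreviations
  set Ψ : E2 → ℝ := fun z => ∫ y : E2, φ y * φ (y - z) with hΨ
  set g : ℕ → ℝ := fun n => criticalTwoPoint 3 (Pi.single 0 ((2 * n : ℕ) : ℤ)) with hg
  have hgpos : ∀ n, 0 < g n := fun n => criticalTwoPoint_axis_pos (2 * n)
  set T : ℕ → ℝ := fun n => ∑ u ∈ layerBox R n, ∑ v ∈ layerBox R n,
    profileCoeff φ n u * profileCoeff φ n v * criticalTwoPoint 3 (Fin.cons 0 (u - v)) with hT
  set U : ℕ → ℝ := fun n => ∑ z ∈ layerBox (2 * R) n,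
    Ψ ((n : ℝ)⁻¹ • planeVec z) / (n : ℝ) ^ 2 * criticalTwoPoint 3 (Fin.cons 0 z) with hU
  set M : ℕ → ℝ := fun n => ∑ z ∈ layerBox (2 * R) n, criticalTwoPoint 3 (Fin.cons 0 z) / (n : ℝ) ^ 2
    with hM
  -- (1) `U_n / g_n → 4^Δ ∫ Ψ ‖·‖^{-2Δ} = 4^Δ ∫∫ φ φ ‖v - w‖^{-2Δ}`
  have hUlim : Tendsto (fun n => U n / g n) atTop
      (𝓝 ((4:ℝ) ^ Δ * ∫ v : E2, ∫ w : E2, φ v * φ w * ‖v - w‖ ^ (-(2 * Δ)))) := by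
    have h := hker Ψ (2 * R) hΨc hΨs
    rw [hFub]
    exact h
  -- (2) `(T_n - U_n) / g_n → 0`
  have hDlim : Tendsto (fun n => (T n - U n) / g n) atTop (𝓝 0) := by
    rw [Metric.tendsto_nhds]
    intro ε hε
    set C' : ℝ := max C 0 + 1 with hC'
    have hC'pos : 0 < C' := by rw [hC']; positivity
    have hη : 0 < ε / (2 * C') := by positivity
    filter_upwards [hB2a φ R hφc hφs (ε / (2 * C')) hη, hC] with n hn hCn
    have hMn : M n ≤ C' * g n := by
      calc M n ≤ C * g n := hCn
        _ ≤ C' * g n := by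
          apply mul_le_mul_of_nonneg_right _ (hgpos n).le
          rw [hC']; linarith [le_max_left C 0]
    rw [Real.dist_0_eq_abs, abs_div, abs_of_pos (hgpos n), div_lt_iff₀ (hgpos n)]
    calc |T n - U n| ≤ ε / (2 * C') * M n := hn
      _ ≤ ε / (2 * C') * (C' * g n) := mul_le_mul_of_nonneg_left hMn hη.le
      _ = ε / 2 * g n := by field_simp
      _ < ε * g n := by nlinarith [hgpos n]
  -- (3) assemble and match the registered form
  have h := hDlim.add hUlim
  rw [zero_add] at h
  have h' : Tendsto (fun n => T n / g n) atTop
      (𝓝 ((4:ℝ) ^ Δ * ∫ v : E2, ∫ w : E2, φ v * φ w * ‖v - w‖ ^ (-(2 * Δ)))) := by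
    refine h.congr' (Eventually.of_forall fun n => ?_)
    simp only
    field_simp
    ring
  simpa only [hT, hg, layerBox, profileCoeff, planeVec] using h'

/-- **B from B1 + B2** (the planner's `stub_formRiemannLimit`, now a theorem modulo the two registered
Riemann-sum stubs): `layerRegressionForm(n, layerBox R n, n⁻²φ(·/n))/G(2n e₀) = 1 − 2·X_n/G(2n e₀) + Y_n/G(2n e₀)
→ 1 − 2·4^Δ⟨φ,p₁⟩ + 4^Δ⟨φ,Kφ⟩ = 1 − 4^Δ·Q_Δ(φ)`. [folklore] -/
theorem formRiemannLimit_of_stubs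
    (hB1 : ∀ (ρ : ℝ → ℝ) (Δ : ℝ) (S : CorrFamily 3), (∀ δ ∈ Set.Ioc (0:ℝ) 1, 0 < ρ δ) →
      HasPointwiseScalingLimit (criticalCorr 3) ρ S → IsNondegenerateTwoPoint S →
      IsMoebiusCovariant Δ S →
      ∀ (φ : EuclideanSpace ℝ (Fin 2) → ℝ) (R : ℕ), Continuous φ →
        (∀ v : EuclideanSpace ℝ (Fin 2), (R : ℝ) ≤ ‖v‖ → φ v = 0) →
        Tendsto (fun n : ℕ =>
            (∑ u ∈ Fintype.piFinset (fun _ : Fin 2 => Finset.Icc (-((R * n : ℕ) : ℤ)) ((R * n : ℕ) : ℤ)),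
              φ ((n : ℝ)⁻¹ • (WithLp.toLp 2 fun i => (u i : ℝ))) / (n : ℝ) ^ 2 *
                criticalTwoPoint 3 (Fin.cons (n : ℤ) u)) /
            criticalTwoPoint 3 (Pi.single 0 ((2 * n : ℕ) : ℤ)))
          atTop (𝓝 ((4:ℝ) ^ Δ * ∫ v : EuclideanSpace ℝ (Fin 2), φ v * (1 + ‖v‖ ^ 2) ^ (-Δ))))
    (hB2 : ∀ (ρ : ℝ → ℝ) (Δ : ℝ) (S : CorrFamily 3), (∀ δ ∈ Set.Ioc (0:ℝ) 1, 0 < ρ δ) →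
      HasPointwiseScalingLimit (criticalCorr 3) ρ S → IsNondegenerateTwoPoint S →
      IsMoebiusCovariant Δ S →
      ∀ (φ : EuclideanSpace ℝ (Fin 2) → ℝ) (R : ℕ), Continuous φ →
        (∀ v : EuclideanSpace ℝ (Fin 2), (R : ℝ) ≤ ‖v‖ → φ v = 0) →
        Tendsto (fun n : ℕ =>
            (∑ u ∈ Fintype.piFinset (fun _ : Fin 2 => Finset.Icc (-((R * n : ℕ) : ℤ)) ((R * n : ℕ) : ℤ)),
              ∑ v ∈ Fintype.piFinset (fun _ : Fin 2 => Finset.Icc (-((R * n : ℕ) : ℤ)) ((R * n : ℕ) : ℤ)),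
                φ ((n : ℝ)⁻¹ • (WithLp.toLp 2 fun i => (u i : ℝ))) / (n : ℝ) ^ 2 *
                  (φ ((n : ℝ)⁻¹ • (WithLp.toLp 2 fun i => (v i : ℝ))) / (n : ℝ) ^ 2) *
                  criticalTwoPoint 3 (Fin.cons 0 (u - v))) /
            criticalTwoPoint 3 (Pi.single 0 ((2 * n : ℕ) : ℤ)))
          atTop (𝓝 ((4:ℝ) ^ Δ * ∫ v : EuclideanSpace ℝ (Fin 2), ∫ w : EuclideanSpace ℝ (Fin 2),
            φ v * φ w * ‖v - w‖ ^ (-(2 * Δ))))) :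
    ∀ (ρ : ℝ → ℝ) (Δ : ℝ) (S : CorrFamily 3), (∀ δ ∈ Set.Ioc (0:ℝ) 1, 0 < ρ δ) →
      HasPointwiseScalingLimit (criticalCorr 3) ρ S → IsNondegenerateTwoPoint S →
      IsMoebiusCovariant Δ S →
      ∀ (φ : E2 → ℝ) (R : ℕ), Continuous φ → (∀ v : E2, (R : ℝ) ≤ ‖v‖ → φ v = 0) →
        Tendsto (fun n : ℕ => layerRegressionForm n (layerBox R n) (profileCoeff φ n) /
            criticalTwoPoint 3 (Pi.single 0 ((2 * n : ℕ) : ℤ)))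
          atTop (𝓝 (1 - (4:ℝ) ^ Δ * contQ Δ φ)) := by
  intro ρ Δ S hρ hlim hnd hMo φ R hφc hφs
  have h1 := hB1 ρ Δ S hρ hlim hnd hMo φ R hφc hφs
  have h2 := hB2 ρ Δ S hρ hlim hnd hMo φ R hφc hφs
  have hlimit : 1 - (4:ℝ) ^ Δ * contQ Δ φ =
      1 - 2 * ((4:ℝ) ^ Δ * ∫ v : E2, φ v * (1 + ‖v‖ ^ 2) ^ (-Δ)) +
        (4:ℝ) ^ Δ * ∫ v : E2, ∫ w : E2, φ v * φ w * ‖v - w‖ ^ (-(2 * Δ)) := by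
    simp only [contQ]; ring
  rw [hlimit]
  refine ((tendsto_const_nhds.sub (h1.const_mul 2)).add h2).congr' ?_
  filter_upwards with n
  have hG : criticalTwoPoint 3 (Pi.single 0 ((2 * n : ℕ) : ℤ)) ≠ 0 :=
    (criticalTwoPoint_axis_pos (2 * n)).ne'
  simp only [layerRegressionForm, layerBox, profileCoeff, planeVec]
  field_simp

/-- **Lead c1's stub B2 `stub_doubleTermLimit` as a THEOREM** (B2a p127772 + B2b p128164 + B2c p127612 + the
glue above): under the crux hypotheses, `Σ_{u,v} n⁻²φ(u/n)n⁻²φ(v/n)G((0,u−v))/G(2n e₀) → 4^Δ∫∫φ(v)φ(w)‖v−w‖^{−2Δ}`.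
[folklore] -/
theorem stub_doubleTermLimit :
    ∀ (ρ : ℝ → ℝ) (Δ : ℝ) (S : CorrFamily 3), (∀ δ ∈ Set.Ioc (0:ℝ) 1, 0 < ρ δ) →
      HasPointwiseScalingLimit (criticalCorr 3) ρ S → IsNondegenerateTwoPoint S →
      IsMoebiusCovariant Δ S →
      ∀ (φ : EuclideanSpace ℝ (Fin 2) → ℝ) (R : ℕ), Continuous φ →
        (∀ v : EuclideanSpace ℝ (Fin 2), (R : ℝ) ≤ ‖v‖ → φ v = 0) →
        Tendsto (fun n : ℕ =>
            (∑ u ∈ Fintype.piFinset (fun _ : Fin 2 => Finset.Icc (-((R * n : ℕ) : ℤ)) ((R * n : ℕ) : ℤ)),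
              ∑ v ∈ Fintype.piFinset (fun _ : Fin 2 => Finset.Icc (-((R * n : ℕ) : ℤ)) ((R * n : ℕ) : ℤ)),
                φ ((n : ℝ)⁻¹ • (WithLp.toLp 2 fun i => (u i : ℝ))) / (n : ℝ) ^ 2 *
                  (φ ((n : ℝ)⁻¹ • (WithLp.toLp 2 fun i => (v i : ℝ))) / (n : ℝ) ^ 2) *
                  criticalTwoPoint 3 (Fin.cons 0 (u - v))) /
            criticalTwoPoint 3 (Pi.single 0 ((2 * n : ℕ) : ℤ)))
          atTop (𝓝 ((4:ℝ) ^ Δ * ∫ v : EuclideanSpace ℝ (Fin 2), ∫ w : EuclideanSpace ℝ (Fin 2),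
            φ v * φ w * ‖v - w‖ ^ (-(2 * Δ)))) :=
  doubleTermLimit_of_stubs stub_doubleTermAutocorrelation stub_doubleTermKernelSum stub_doubleTermFubini

/-- **The planner's stub B `stub_formRiemannLimit` as a THEOREM** (B1 p126768 + B2 above + lead c1's glue): under
the crux hypotheses, for every test profile `φ` supported in the ball of radius `R`,
`layerRegressionForm(n, layerBox R n, n⁻²φ(·/n)) / G(2n e₀) → 1 − 4^Δ·Q_Δ(φ)`. [folklore] -/
theorem stub_formRiemannLimit :
    ∀ (ρ : ℝ → ℝ) (Δ : ℝ) (S : CorrFamily 3), (∀ δ ∈ Set.Ioc (0:ℝ) 1, 0 < ρ δ) →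
      HasPointwiseScalingLimit (criticalCorr 3) ρ S → IsNondegenerateTwoPoint S →
      IsMoebiusCovariant Δ S →
      ∀ (φ : E2 → ℝ) (R : ℕ), Continuous φ → (∀ v : E2, (R : ℝ) ≤ ‖v‖ → φ v = 0) →
        Tendsto (fun n : ℕ => layerRegressionForm n (layerBox R n) (profileCoeff φ n) /
            criticalTwoPoint 3 (Pi.single 0 ((2 * n : ℕ) : ℤ)))
          atTop (𝓝 (1 - (4:ℝ) ^ Δ * contQ Δ φ)) :=
  formRiemannLimit_of_stubs stub_crossTermLimit stub_doubleTermLimit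

end Summit.CriticalPhenomena.Ising3DConformalLimit.Cruxes.GaussianLimitNotScreened.SingleLayerLinearRegression

end
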